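import Mathlib.Algebra.Group.Shrink
import Mathlib.Data.Countable.Small
import Literature.AnabelianGeometry.SemiGraphs.TemperoidsHomFibre
import Literature.AnabelianGeometry.SemiGraphs.TemperoidsResProofs

/-!
# [SemiAnbd] Proposition 3.2: the torsors `F(Π₂/N)` of a morphism of connected temperoids

Mochizuki, *Semi-graphs of anabelioids*, Publ. RIMS **42** (2006) 221–322, §3, Proposition 3.2,
author's manuscript p. 35 [cite: MochizukiSemiAnbd2006, Prop 3.2 p.35].  Proof-only tool file (no
definitions) towards the named fact `TemperoidHomEqRes` of `Temperoids.lean`: for a functor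
`F : B^temp(Π₂) ⥤ B^temp(Π₁)` preserving finite limits and countable colimits and an open normal
subgroup `N` of the tempered group `Π₂`, the underlying set `Y_N` of `F(Π₂/N)` carries the right
action of `Π₂` through the endomorphisms `F(r_h)` (`r_h` = right multiplication by `h` on `Π₂/N`,
`TemperoidsResProofs.rightMul`), and

* `map_orbitMap`: for an open subgroup `H ⊇ N`, `F` of the projection `Π₂/N → Π₂/H` is surjective
  with fibres the `H`-orbits (the projection is the quotient of `Π₂/N` by the countable group
  `HN/N`, a countable colimit);
* hence (`H = Π₂`, where `Π₂/Π₂` is the one-point object) `Y_N` is nonempty and `Π₂` acts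
  transitively on it; and `Π₂/N` acts freely (`r_g` is fixed-point-free for `g ∉ N`).

So `Y_N` is a `Π₂/N`-torsor with a commuting `Π₁`-action — the key to reconstructing the
homomorphism `Π₁ → Π₂` in Proposition 3.2.
-/

namespace Literature.AnabelianGeometry.SemiGraphs

namespace BTemp

open CategoryTheory CategoryTheory.Limits Topology

universe u

section Bookkeeping

variable {G : Type u} [Group G] [TopologicalSpace G]

/-- Morphisms of `B^temp(Π)` are determined by their underlying maps. [folklore] -/
private theorem hom_ext' {X Y : BTemp G} (f g : X ⟶ Y) (h : ∀ x, f.hom.hom x = g.hom.hom x) :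
    f = g := by
  apply ObjectProperty.hom_ext
  apply Action.Hom.ext
  exact ConcreteCategory.hom_ext _ _ h

variable [IsTopologicalGroup G] (hG : IsTempered G)

/-- Right multiplication on a general coset. [cite: MochizukiSemiAnbd2006, Rmk 3.1.2 p.33] -/
theorem rightMul_apply' (N : OpenNormalSubgroup G) (y : G) (q : G ⧸ N.toSubgroup) :
    (rightMul hG N y).hom.hom q = q * (y : G ⧸ N.toSubgroup) := by
  obtain ⟨z, rfl⟩ := QuotientGroup.mk_surjective q
  rw [rightMul_apply, QuotientGroup.mk_mul]

/-- The action on the object `Π/H` is left multiplication. [cite: MochizukiSemiAnbd2006, Rmk 3.1.2 p.33] -/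
theorem quotientObj_ρ_apply (H : Subgroup G) (hH : IsOpen (H : Set G)) (g z : G) :
    (BTemp.quotientObj G hG H hH).obj.ρ g (z : G ⧸ H) = ((g * z : G) : G ⧸ H) := by
  change g • (z : G ⧸ H) = _
  rw [MulAction.Quotient.smul_coe, smul_eq_mul]

/-- An open normal subgroup `N ⊆ H` fixes the base point of `Π/H`. [cite: MochizukiSemiAnbd2006, Rmk 3.1.2 p.33] -/
theorem le_stab_quotientObj_one (N : OpenNormalSubgroup G) (H : Subgroup G)
    (hH : IsOpen (H : Set G)) (hNH : N.toSubgroup ≤ H) :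
    N.toSubgroup ≤ stab (BTemp.quotientObj G hG H hH) ((1 : G) : G ⧸ H) := by
  intro g hg
  change (BTemp.quotientObj G hG H hH).obj.ρ g ((1 : G) : G ⧸ H) = ((1 : G) : G ⧸ H)
  rw [quotientObj_ρ_apply, mul_one]
  change (g : G ⧸ H) = ((1 : G) : G ⧸ H)
  rw [QuotientGroup.eq, mul_one]
  exact H.inv_mem (hNH hg)

/-- The projection `Π/N → Π/H` (the orbit map of the base point) on cosets.
[cite: MochizukiSemiAnbd2006, Rmk 3.1.2 p.33] -/
theorem orbitMap_quotientObj_apply (N : OpenNormalSubgroup G) (H : Subgroup G)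
    (hH : IsOpen (H : Set G)) (hN : N.toSubgroup ≤ stab (BTemp.quotientObj G hG H hH) ((1 : G) : G ⧸ H))
    (z : G) :
    (orbitMap hG (BTemp.quotientObj G hG H hH) ((1 : G) : G ⧸ H) N hN).hom.hom
      (z : G ⧸ N.toSubgroup) = (z : G ⧸ H) := by
  rw [orbitMap_apply, quotientObj_ρ_apply, mul_one]

/-- Right multiplications compose: `r_a ≫ r_b = r_{ab}`. [cite: MochizukiSemiAnbd2006, Rmk 3.1.2 p.33] -/
theorem rightMul_comp (N : OpenNormalSubgroup G) (a b : G) :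
    rightMul hG N a ≫ rightMul hG N b = rightMul hG N (a * b) := by
  apply hom_ext'
  intro q
  change (rightMul hG N b).hom.hom ((rightMul hG N a).hom.hom q) = _
  rw [rightMul_apply', rightMul_apply', rightMul_apply', QuotientGroup.mk_mul, mul_assoc]

/-- Right multiplication by `1` is the identity. [cite: MochizukiSemiAnbd2006, Rmk 3.1.2 p.33] -/
theorem rightMul_one (N : OpenNormalSubgroup G) : rightMul hG N 1 = 𝟙 (Q hG N) := by
  apply hom_ext'
  intro q
  rw [rightMul_apply', QuotientGroup.mk_one, mul_one]
  rfl

/-- Right multiplication only depends on the coset. [cite: MochizukiSemiAnbd2006, Rmk 3.1.2 p.33] -/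
theorem rightMul_eq_of_coe_eq (N : OpenNormalSubgroup G) {a b : G}
    (h : (a : G ⧸ N.toSubgroup) = b) : rightMul hG N a = rightMul hG N b := by
  apply hom_ext'
  intro q
  rw [rightMul_apply', rightMul_apply', h]

/-- Right multiplications commute with the projections `Π/N → Π/M`.
[cite: MochizukiSemiAnbd2006, Rmk 3.1.2 p.33] -/
theorem rightMul_proj {N M : OpenNormalSubgroup G} (h : N ≤ M) (g : G) :
    rightMul hG N g ≫ proj hG h = proj hG h ≫ rightMul hG M g := by
  apply hom_ext'
  intro q
  obtain ⟨z, rfl⟩ := QuotientGroup.mk_surjective q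
  change (proj hG h).hom.hom ((rightMul hG N g).hom.hom (z : G ⧸ N.toSubgroup)) =
    (rightMul hG M g).hom.hom ((proj hG h).hom.hom (z : G ⧸ N.toSubgroup))
  rw [rightMul_apply, proj_apply, proj_apply, rightMul_apply]

/-- The projection `Π/N → Π/M` is the orbit map of the base point of `Π/M`.
[cite: MochizukiSemiAnbd2006, Rmk 3.1.2 p.33] -/
theorem proj_eq_orbitMap {N M : OpenNormalSubgroup G} (h : N ≤ M)
    (hN : N.toSubgroup ≤ stab (Q hG M) ((1 : G) : G ⧸ M.toSubgroup)) :
    proj hG h = orbitMap hG (Q hG M) ((1 : G) : G ⧸ M.toSubgroup) N hN := by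
  apply hom_ext'
  intro q
  obtain ⟨z, rfl⟩ := QuotientGroup.mk_surjective q
  rw [proj_apply]
  exact (orbitMap_quotientObj_apply hG N M.toSubgroup M.isOpen' hN z).symm

/-- Equivariance of `B^temp`-morphisms on elements ("morphisms of `Π`-sets", §3 p. 33).
[cite: MochizukiSemiAnbd2006, §3 p.33] -/
theorem hom_hom_ρ {G' : Type u} [Group G'] [TopologicalSpace G'] {X Y : BTemp G'} (f : X ⟶ Y)
    (g : G') (x : X.obj.V) : f.hom.hom (X.obj.ρ g x) = Y.obj.ρ g (f.hom.hom x) := by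
  have e := ConcreteCategory.congr_hom (f.hom.comm g) x
  simpa only [types_comp_apply] using e

end Bookkeeping

variable {G₁ : Type u} [Group G₁] [TopologicalSpace G₁] [IsTopologicalGroup G₁]
  {G₂ : Type u} [Group G₂] [TopologicalSpace G₂] [IsTopologicalGroup G₂] (hG₂ : IsTempered G₂)
  (F : BTemp G₂ ⥤ BTemp G₁) (hlim : PreservesFiniteLimits F)
  (hcolim : ∀ (J : Type) [SmallCategory J] [CountableCategory J], PreservesColimitsOfShape J F)

/-- Transitivity of the object `Π/H` from its base point. [cite: MochizukiSemiAnbd2006, Rmk 3.1.2 p.33] -/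
theorem quotientObj_transitive (H : Subgroup G₂) (hH : IsOpen (H : Set G₂))
    (x : (BTemp.quotientObj G₂ hG₂ H hH).obj.V) :
    ∃ g : G₂, (BTemp.quotientObj G₂ hG₂ H hH).obj.ρ g ((1 : G₂) : G₂ ⧸ H) = x := by
  obtain ⟨g, rfl⟩ := QuotientGroup.mk_surjective x
  exact ⟨g, by rw [quotientObj_ρ_apply, mul_one]⟩

include hcolim in
/-- `F` of an orbit map `Π₂/N → X`, `gN ↦ g · x₀` (`X` transitive, `N` fixing `x₀`) is surjective with
fibres the orbits of the stabiliser `H` of `x₀` under the right action `F(r_h)`: the orbit map is the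
quotient of `Π₂/N` by the countable group `HN/N` and `F` preserves countable colimits
(`map_quotient`).  For `X = Π₂/H` this is `F` of the projection `Π₂/N → Π₂/H`.
[cite: MochizukiSemiAnbd2006, Prop 3.2 p.35] -/
theorem map_orbitMap (N : OpenNormalSubgroup G₂) (X : BTemp G₂) (x₀ : X.obj.V)
    (htr : ∀ x : X.obj.V, ∃ g : G₂, X.obj.ρ g x₀ = x) (hN : N.toSubgroup ≤ stab X x₀) :
    (∀ z : (F.obj X).obj.V, ∃ y : (F.obj (Q hG₂ N)).obj.V,
        (F.map (orbitMap hG₂ X x₀ N hN)).hom.hom y = z) ∧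
    ∀ y y' : (F.obj (Q hG₂ N)).obj.V,
      (F.map (orbitMap hG₂ X x₀ N hN)).hom.hom y = (F.map (orbitMap hG₂ X x₀ N hN)).hom.hom y' ↔
      ∃ h ∈ stab X x₀, (F.map (rightMul hG₂ N h)).hom.hom y = y' := by
  classical
  -- the subgroup `L = HN/N` of `Π₂/N` (`H` the stabiliser of `x₀`) and a small copy `K` of it
  let L : Subgroup (G₂ ⧸ N.toSubgroup) := (stab X x₀).map (QuotientGroup.mk' N.toSubgroup)
  haveI : Countable (G₂ ⧸ N.toSubgroup) := hG₂.countable_quotient N.toSubgroup N.isOpen'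
  let K : Type := Shrink.{0} L
  haveI : Countable K := Countable.of_equiv (↥L) (equivShrink.{0} (↥L))
  let e : K ≃* L := Shrink.mulEquiv
  -- right multiplication by a coset, as an endomorphism of `Π₂/N`
  have hequiv : ∀ (m : G₂ ⧸ N.toSubgroup) (g : G₂) (q : G₂ ⧸ N.toSubgroup),
      (fun q : G₂ ⧸ N.toSubgroup => q * m) ((Q hG₂ N).obj.ρ g q) =
        (Q hG₂ N).obj.ρ g ((fun q : G₂ ⧸ N.toSubgroup => q * m) q) := by
    intro m g q
    obtain ⟨z, rfl⟩ := QuotientGroup.mk_surjective q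
    obtain ⟨w, rfl⟩ := QuotientGroup.mk_surjective m
    simp only [Q_ρ_apply, ← QuotientGroup.mk_mul, mul_assoc]
  let r : (G₂ ⧸ N.toSubgroup) → (Q hG₂ N ⟶ Q hG₂ N) := fun m =>
    homOfEquivariant (Q hG₂ N) (Q hG₂ N) (fun q : G₂ ⧸ N.toSubgroup => q * m) (hequiv m)
  have r_apply : ∀ m (q : G₂ ⧸ N.toSubgroup), (r m).hom.hom q = q * m := fun m q => rfl
  have r_eq_rightMul : ∀ w : G₂, r (w : G₂ ⧸ N.toSubgroup) = rightMul hG₂ N w := fun w =>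
    hom_ext' _ _ fun q => by rw [r_apply, rightMul_apply']
  let a : K →* End (Q hG₂ N) :=
    { toFun := fun k => r ((e k : L) : G₂ ⧸ N.toSubgroup)⁻¹
      map_one' := by
        apply hom_ext'
        intro q
        rw [r_apply, map_one, OneMemClass.coe_one, inv_one, mul_one]
        rfl
      map_mul' := fun k k' => by
        apply hom_ext'
        intro q
        change (r _).hom.hom q = (r _).hom.hom ((r _).hom.hom q)
        rw [r_apply, r_apply, r_apply, map_mul, Subgroup.coe_mul, mul_inv_rev, mul_assoc] }
  have a_apply : ∀ k, (a k : End (Q hG₂ N)) = r ((e k : L) : G₂ ⧸ N.toSubgroup)⁻¹ := fun k => rfl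
  -- every `a k` is an `r_h`, `h ∈ H`, and conversely
  have hak : ∀ k : K, ∃ h ∈ stab X x₀, (a k : End (Q hG₂ N)) = rightMul hG₂ N h := by
    intro k
    obtain ⟨h, hh, hhk⟩ := Subgroup.mem_map.mp (L.inv_mem (e k).2)
    refine ⟨h, hh, ?_⟩
    rw [a_apply, ← r_eq_rightMul, ← hhk, QuotientGroup.mk'_apply]
  have hka : ∀ h ∈ stab X x₀, ∃ k : K, (a k : End (Q hG₂ N)) = rightMul hG₂ N h := by
    intro h hh
    have hmem : ((h : G₂ ⧸ N.toSubgroup))⁻¹ ∈ L :=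
      L.inv_mem (Subgroup.mem_map.mpr ⟨h, hh, rfl⟩)
    refine ⟨e.symm ⟨_, hmem⟩, ?_⟩
    rw [a_apply, MulEquiv.apply_symm_apply, Subgroup.coe_mk, inv_inv, r_eq_rightMul]
  -- the orbit map is invariant, surjective, with fibres the `L`-orbits
  set π := orbitMap hG₂ X x₀ N hN with hπdef
  have hρmul : ∀ (g g' : G₂) (x : X.obj.V), X.obj.ρ (g * g') x = X.obj.ρ g (X.obj.ρ g' x) := by
    intro g g' x
    rw [map_mul]
    rfl
  have hπa : ∀ k, a k ≫ π = π := by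
    intro k
    obtain ⟨h, hh, hk⟩ := hak k
    rw [hk]
    apply hom_ext'
    intro q
    obtain ⟨z, rfl⟩ := QuotientGroup.mk_surjective q
    change π.hom.hom ((rightMul hG₂ N h).hom.hom (z : G₂ ⧸ N.toSubgroup)) =
      π.hom.hom (z : G₂ ⧸ N.toSubgroup)
    rw [rightMul_apply, hπdef, orbitMap_apply, orbitMap_apply, hρmul]
    exact congrArg _ hh
  have hsurj : ∀ w : X.obj.V, ∃ q : (Q hG₂ N).obj.V, π.hom.hom q = w := by
    intro w
    obtain ⟨g, hg⟩ := htr w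
    exact ⟨(g : G₂ ⧸ N.toSubgroup), by rw [hπdef, orbitMap_apply]; exact hg⟩
  have hfib : ∀ q q' : (Q hG₂ N).obj.V, π.hom.hom q = π.hom.hom q' →
      ∃ k, (a k).hom.hom q = q' := by
    intro q q' hqq
    obtain ⟨z, rfl⟩ := QuotientGroup.mk_surjective q
    obtain ⟨z', rfl⟩ := QuotientGroup.mk_surjective q'
    rw [hπdef, orbitMap_apply, orbitMap_apply] at hqq
    have hmem' : z⁻¹ * z' ∈ stab X x₀ := by
      change X.obj.ρ (z⁻¹ * z') x₀ = x₀
      rw [hρmul, ← hqq, ← hρmul, inv_mul_cancel, map_one]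
      rfl
    have hmem : ((z⁻¹ * z' : G₂) : G₂ ⧸ N.toSubgroup) ∈ L :=
      Subgroup.mem_map.mpr ⟨_, hmem', rfl⟩
    refine ⟨(e.symm ⟨_, hmem⟩)⁻¹, ?_⟩
    change (r _).hom.hom (z : G₂ ⧸ N.toSubgroup) = (z' : G₂ ⧸ N.toSubgroup)
    rw [r_apply, map_inv, MulEquiv.apply_symm_apply, InvMemClass.coe_inv, Subgroup.coe_mk, inv_inv,
      ← QuotientGroup.mk_mul, mul_inv_cancel_left]
  obtain ⟨hs, hf⟩ := map_quotient F hcolim a π hπa hsurj hfib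
  refine ⟨hs, fun y y' => (hf y y').trans ⟨?_, ?_⟩⟩
  · rintro ⟨k, hk⟩
    obtain ⟨h, hh, hkh⟩ := hak k
    refine ⟨h, hh, ?_⟩
    rw [← hk]
    change _ = (F.map (a k : End (Q hG₂ N))).hom.hom y
    rw [hkh]
  · rintro ⟨h, hh, hk⟩
    obtain ⟨k, hkh⟩ := hka h hh
    refine ⟨k, ?_⟩
    change (F.map (a k : End (Q hG₂ N))).hom.hom y = y'
    rw [hkh, hk]

include hlim hcolim in
/-- `Y_N = F(Π₂/N)` is nonempty and `Π₂` acts transitively on it by the `F(r_g)`: apply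
`map_orbitMap` to `H = Π₂` (the quotient `Π₂/Π₂` is the one-point object, which `F` preserves).
[cite: MochizukiSemiAnbd2006, Prop 3.2 p.35] -/
theorem fibreQ_transitive (N : OpenNormalSubgroup G₂) :
    Nonempty (F.obj (Q hG₂ N)).obj.V ∧
    ∀ y y' : (F.obj (Q hG₂ N)).obj.V, ∃ g : G₂, (F.map (rightMul hG₂ N g)).hom.hom y = y' := by
  have htop : IsOpen ((⊤ : Subgroup G₂) : Set G₂) := by
    rw [Subgroup.coe_top]
    exact isOpen_univ
  have hN := le_stab_quotientObj_one hG₂ N ⊤ htop le_top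
  obtain ⟨hs, hf⟩ := map_orbitMap hG₂ F hcolim N (BTemp.quotientObj G₂ hG₂ ⊤ htop)
    ((1 : G₂) : G₂ ⧸ (⊤ : Subgroup G₂)) (quotientObj_transitive hG₂ ⊤ htop) hN
  haveI : Subsingleton (G₂ ⧸ (⊤ : Subgroup G₂)) := QuotientGroup.subsingleton_quotient_top
  haveI : Unique (BTemp.quotientObj G₂ hG₂ ⊤ htop).obj.V :=
    { default := (show G₂ ⧸ (⊤ : Subgroup G₂) from ((1 : G₂) : G₂ ⧸ (⊤ : Subgroup G₂)))
      uniq := fun a => Subsingleton.elim (α := G₂ ⧸ (⊤ : Subgroup G₂)) _ _ }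
  obtain ⟨⟨z⟩, hsub⟩ := map_singleton F hlim (BTemp.quotientObj G₂ hG₂ ⊤ htop)
  refine ⟨?_, fun y y' => ?_⟩
  · obtain ⟨y, -⟩ := hs z
    exact ⟨y⟩
  · obtain ⟨h, -, hh⟩ := (hf y y').mp (hsub.elim _ _)
    exact ⟨h, hh⟩

include hlim hcolim in
/-- `Π₂/N` acts freely on `Y_N = F(Π₂/N)`: `F(r_g)` has no fixed point unless `g ∈ N`
(`r_g` is fixed-point-free on `Π₂/N`, and `F` preserves that). [cite: MochizukiSemiAnbd2006, Prop 3.2 p.35] -/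
theorem fibreQ_free (N : OpenNormalSubgroup G₂) {g : G₂} (hg : g ∉ N.toSubgroup)
    (y : (F.obj (Q hG₂ N)).obj.V) : (F.map (rightMul hG₂ N g)).hom.hom y ≠ y := by
  apply map_fixedPointFree F hlim hcolim
  intro q hq
  obtain ⟨z, rfl⟩ := QuotientGroup.mk_surjective q
  rw [rightMul_apply] at hq
  change ((z * g : G₂) : G₂ ⧸ N.toSubgroup) = (z : G₂ ⧸ N.toSubgroup) at hq
  rw [QuotientGroup.eq, mul_inv_rev, mul_assoc, inv_mul_cancel, mul_one] at hq
  exact hg ((Subgroup.inv_mem_iff _).mp hq)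

include hlim hcolim in
/-- Freeness, injective form: `F(r_g) y = F(r_{g'}) y` forces `g ≡ g' (mod N)`.
[cite: MochizukiSemiAnbd2006, Prop 3.2 p.35] -/
theorem fibreQ_coe_eq_of_rightMul_eq (N : OpenNormalSubgroup G₂) {g g' : G₂}
    {y : (F.obj (Q hG₂ N)).obj.V}
    (h : (F.map (rightMul hG₂ N g)).hom.hom y = (F.map (rightMul hG₂ N g')).hom.hom y) :
    (g : G₂ ⧸ N.toSubgroup) = g' := by
  have h1 : (F.map (rightMul hG₂ N (g * g'⁻¹))).hom.hom y = y := by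
    have h2 := congrArg (fun w => (F.map (rightMul hG₂ N g'⁻¹)).hom.hom w) h
    simp only at h2
    change (F.map (rightMul hG₂ N g) ≫ F.map (rightMul hG₂ N g'⁻¹)).hom.hom y =
      (F.map (rightMul hG₂ N g') ≫ F.map (rightMul hG₂ N g'⁻¹)).hom.hom y at h2
    rw [← F.map_comp, ← F.map_comp, rightMul_comp, rightMul_comp, mul_inv_cancel,
      rightMul_one, F.map_id] at h2
    exact h2
  by_contra hne
  refine fibreQ_free hG₂ F hlim hcolim N ?_ y h1
  intro hmem
  apply hne
  rw [← mul_inv_eq_one, ← QuotientGroup.mk_inv, ← QuotientGroup.mk_mul]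
  exact (QuotientGroup.eq_one_iff _).mpr hmem

end BTemp

end Literature.AnabelianGeometry.SemiGraphs
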